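import Summits.QuantumAdvantage.QuantumAdvantage.Theses.SymplecticPurity
import Summits.QuantumAdvantage.QuantumAdvantage.Theorems.SymplecticPurityCubeGraphFlatField
import Summits.QuantumAdvantage.QuantumAdvantage.Theorems.SpinorFlatteningNegApproxGaussRankSuperpolyMagicInvariant
import Literature.Computability.QuantumComplexity.DecisionDiagrams

/-!
# Route `SymplecticPurity`, item `CubeGraphFlat` (stmt-QuantumAdvantage-9836) — PROOF

`theorem CubeGraphFlat_proof : …Theses.SymplecticPurity.CubeGraphFlat`: for every finite field `K`
with `2 ^ n` elements and every additive identification `e : K ≃+ (Fin n → ZMod 2)`, the unnormalised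
graph vector `g = Σ_x |x⟩|e((e⁻¹x)³)⟩` on `n + n` qubits satisfies `|⟨g| σ_S |g⟩| ≤ 2 · √2 ^ n` for
every Pauli string `S ≠ I` (the data-loading state of the cube S-box is `2^{1−n/2}`-flat).

Structure (the S-box dictionary of the route, specialised to `x ↦ x³`):

* `indicator_dot_pauliString_mulVec` — for a `{0,1}`-vector `1_P`, `⟨1_P| σ_S |1_P⟩` is the sum of
  the unimodular row phases over the points `w` with `P w ∧ P (w ⊕ flips S)` (closed form of the
  action of a Pauli string, `SpinorFlattening.magicInvariant_pauliString_mulVec_apply`); hence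
  `norm_indicator_dot_le_card`.
* `card_cube_graph_pairs_le_two` — if `S` flips a bit, those points inject into the solutions of
  `(u + α)³ + u³ = β` with `(α, β) ≠ (0, 0)` the flip pattern read in `K` (additivity of `e`), at most
  two by almost perfect nonlinearity (`card_filter_cube_diff_le_two`, field file).
* `graph_dot_eq_sum_of_noflip` — for a flip-free (`I/Z`) string the expectation in a graph state
  `Σ_x |x⟩|f x⟩` is `Σ_x ∏ rowPhase`, i.e. (`rowPhase_eq_sign_of_noflip`, `prod_sign_eq`) the Walsh sum
  `Σ_u (−1)^{φ u + ψ (u³)}` of the two coordinate masks transported through `e` to additive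
  functionals `φ ψ : K →+ ZMod 2`; it vanishes when `ψ = 0 ≠ φ` and is at most `2 √2 ^ n` in absolute
  value when `ψ ≠ 0` (`abs_walsh_cube_le`, field file: Gold 1968 / Nyberg 1993 near-bentness).

Sources: R. Gold, IEEE Trans. Inform. Theory 14 (1968) 154–156; K. Nyberg, EUROCRYPT '93 (LNCS 765)
55–64; C. Carlet, *Boolean Functions for Cryptography and Coding Theory* (CUP 2021), ch. 11.
-/


namespace Summit.QuantumAdvantage.QuantumAdvantage.Theorems.SymplecticPurity

open Matrix Finset Literature.Computability.QuantumComplexity Literature.Computability.Cryptography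

/-- The row phases of the Pauli letters are unimodular. -/
theorem norm_rowPhase (Q : Pauli) (b : Bool) : ‖Pauli.rowPhase Q b‖ = 1 := by
  cases Q <;> cases b <;> simp [Pauli.rowPhase]

/-- **Expectation of a Pauli string in an indicator vector**: for the `{0,1}`-vector `1_P` of a
predicate `P` on the register, `⟨1_P| σ_S |1_P⟩ = Σ_{w : P w ∧ P (w ⊕ flips S)} ∏_k rowPhase (S k) (w k)`
(row `w` of `σ_S` has its only entry in column `w ⊕ flips S`). -/
theorem indicator_dot_pauliString_mulVec {N : ℕ} (S : Fin N → Pauli) (P : QReg N → Prop)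
    [DecidablePred P] :
    star (fun w => if P w then (1 : ℂ) else 0) ⬝ᵥ
        ((pauliString S) *ᵥ fun w => if P w then (1 : ℂ) else 0) =
      ∑ w ∈ Finset.univ.filter (fun w : QReg N => P w ∧ P (fun k => Bool.xor (w k) (S k).flipsBit)),
        ∏ k, Pauli.rowPhase (S k) (w k) := by
  rw [dotProduct, Finset.sum_filter]
  refine Finset.sum_congr rfl fun w _ => ?_
  rw [SpinorFlattening.magicInvariant_pauliString_mulVec_apply, Pi.star_apply]
  by_cases h1 : P w <;> by_cases h2 : P (fun k => Bool.xor (w k) (S k).flipsBit) <;> simp [h1, h2]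

/-- Triangle inequality: `|⟨1_P| σ_S |1_P⟩| ≤ #{w : P w ∧ P (w ⊕ flips S)}`. -/
theorem norm_indicator_dot_le_card {N : ℕ} (S : Fin N → Pauli) (P : QReg N → Prop)
    [DecidablePred P] :
    ‖star (fun w => if P w then (1 : ℂ) else 0) ⬝ᵥ
        ((pauliString S) *ᵥ fun w => if P w then (1 : ℂ) else 0)‖ ≤
      (Finset.univ.filter (fun w : QReg N => P w ∧ P (fun k => Bool.xor (w k) (S k).flipsBit))).card := by
  rw [indicator_dot_pauliString_mulVec]
  refine (norm_sum_le _ _).trans ?_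
  simp [norm_prod, norm_rowPhase]

/-- A label of `n + m` wires is determined by its first `n` and last `m` coordinates. -/
theorem qreg_ext_of_castAdd_natAdd {n m : ℕ} {w₁ w₂ : QReg (n + m)}
    (hx : (fun i : Fin n => w₁ (Fin.castAdd m i)) = fun i => w₂ (Fin.castAdd m i))
    (hy : (fun j : Fin m => w₁ (Fin.natAdd n j)) = fun j => w₂ (Fin.natAdd n j)) : w₁ = w₂ := by
  rw [← Fin.append_castAdd_natAdd (f := w₁), ← Fin.append_castAdd_natAdd (f := w₂), hx, hy]

/-- **Z-type strings on a graph state**: for `f : QReg n → QReg n` and a string `S` without bit flips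
(letters `I`, `Z` only), `⟨g_f| σ_S |g_f⟩ = Σ_x ∏_i rowPhase (S_i) (x_i) · ∏_j rowPhase (S_{n+j}) (f x)_j`,
where `g_f = Σ_x |x⟩|f x⟩` is the (unnormalised) graph vector. -/
theorem graph_dot_eq_sum_of_noflip {n : ℕ} (f : QReg n → QReg n) (S : Fin (n + n) → Pauli)
    (hfl : ∀ k, (S k).flipsBit = false) :
    star (fun w : QReg (n + n) =>
        if (fun j : Fin n => w (Fin.natAdd n j)) = f (fun i : Fin n => w (Fin.castAdd n i)) then (1 : ℂ) else 0) ⬝ᵥ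
      ((pauliString S) *ᵥ fun w : QReg (n + n) =>
        if (fun j : Fin n => w (Fin.natAdd n j)) = f (fun i : Fin n => w (Fin.castAdd n i)) then (1 : ℂ) else 0) =
    ∑ x : QReg n, (∏ i : Fin n, Pauli.rowPhase (S (Fin.castAdd n i)) (x i)) *
      ∏ j : Fin n, Pauli.rowPhase (S (Fin.natAdd n j)) (f x j) := by
  rw [indicator_dot_pauliString_mulVec]
  simp only [hfl, Bool.xor_false, and_self]
  refine Finset.sum_nbij' (fun w => fun i => w (Fin.castAdd n i)) (fun x => Fin.append x (f x))
    ?_ ?_ ?_ ?_ ?_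
  · intro w _
    exact Finset.mem_univ _
  · intro x _
    rw [Finset.mem_filter]
    refine ⟨Finset.mem_univ _, ?_⟩
    funext j
    simp only [Fin.append_right, Fin.append_left]
  · intro w hw
    rw [Finset.mem_filter] at hw
    rw [← hw.2]
    exact Fin.append_castAdd_natAdd
  · intro x _
    funext i
    exact Fin.append_left _ _ _
  · intro w hw
    rw [Finset.mem_filter] at hw
    rw [Fin.prod_univ_add, ← hw.2]

/-- For a string without bit flips (letters `I`, `Z`), each row phase is the real sign
`(−1)^{[S_k = Z]·b}`. -/
theorem rowPhase_eq_sign_of_noflip {ι : Type*} (S : ι → Pauli) (hfl : ∀ k, (S k).flipsBit = false)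
    (k : ι) (b : Bool) :
    Pauli.rowPhase (S k) b =
      ((if (if S k = Pauli.Z then (1 : ZMod 2) else 0) * (if b then (1 : ZMod 2) else 0) = 0
        then (1 : ℝ) else -1 : ℝ) : ℂ) := by
  have h10 : (1 : ZMod 2) ≠ 0 := by decide
  have hk := hfl k
  revert hk
  cases S k <;> cases b <;> simp [Pauli.flipsBit, Pauli.rowPhase, h10]

/-- A letter without bit flip is `I` or `Z`. -/
theorem eq_I_or_eq_Z_of_flipsBit {Q : Pauli} (hQ : Q.flipsBit = false) : Q = Pauli.I ∨ Q = Pauli.Z := by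
  cases Q <;> simp_all [Pauli.flipsBit]

/-- The bit vector `x ↦ (x_i : ZMod 2)` is injective. -/
theorem bits_injective {n : ℕ} {x y : QReg n}
    (h : (fun i => if x i then (1 : ZMod 2) else 0) = fun i => if y i then (1 : ZMod 2) else 0) : x = y := by
  funext i
  have hi := congrFun h i
  have h10 : (1 : ZMod 2) ≠ 0 := by decide
  revert hi
  cases x i <;> cases y i <;> simp [h10, h10.symm]

/-- The bit vector of `x ⊕ a` is the sum of the bit vectors. -/
theorem bits_xor {n : ℕ} (x a : QReg n) :
    (fun i => if Bool.xor (x i) (a i) then (1 : ZMod 2) else 0) =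
      (fun i => if x i then (1 : ZMod 2) else 0) + fun i => if a i then (1 : ZMod 2) else 0 := by
  funext i
  simp only [Pi.add_apply]
  have h11 : (1 : ZMod 2) + 1 = 0 := by decide
  cases x i <;> cases a i <;> simp [h11]

/-- Bit bookkeeping: if `y ⊕ b = [z₁ = 1]` and `y = [z₂ = 1]` then `z₁ + z₂` is the bit `b`. -/
theorem zmod_two_add_eq_bit (z₁ z₂ : ZMod 2) (b : Bool)
    (h : Bool.xor (decide (z₂ = 1)) b = decide (z₁ = 1)) : z₁ + z₂ = if b then 1 else 0 := by
  revert z₁ z₂ b h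
  decide

/-- Reading a bit back: `[z = 1] = z` in `ZMod 2`. -/
theorem bit_eq_self (z : ZMod 2) : (if z = 1 then (1 : ZMod 2) else 0) = z := by
  revert z
  decide

/-- **X-type strings on the cube graph state** (differential uniformity): if `S` flips at least one
bit, the pairs `{w, w ⊕ flips S}` of graph points number at most two — they inject (via the data
register, read in `K`) into the solutions of `(u + α)³ + u³ = β`, `(α, β) ≠ (0,0)` the flip pattern. -/
theorem card_cube_graph_pairs_le_two {n : ℕ} {K : Type*} [Field K] [Fintype K]
    (hK : Fintype.card K = 2 ^ n) (e : K ≃+ (Fin n → ZMod 2)) (S : Fin (n + n) → Pauli)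
    (hfl : ∃ k, (S k).flipsBit = true) :
    (Finset.univ.filter fun w : QReg (n + n) =>
      ((fun j : Fin n => w (Fin.natAdd n j)) = fun j : Fin n =>
          decide (e ((e.symm fun i : Fin n => if w (Fin.castAdd n i) then 1 else 0) ^ 3) j = 1)) ∧
      ((fun j : Fin n => Bool.xor (w (Fin.natAdd n j)) (S (Fin.natAdd n j)).flipsBit) = fun j : Fin n =>
          decide (e ((e.symm fun i : Fin n =>
            if Bool.xor (w (Fin.castAdd n i)) (S (Fin.castAdd n i)).flipsBit then 1 else 0) ^ 3) j = 1))).card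
      ≤ 2 := by
  classical
  have h10 : (1 : ZMod 2) ≠ 0 := by decide
  -- the flip pattern, read in `K`
  set α : K := e.symm fun i : Fin n => if (S (Fin.castAdd n i)).flipsBit then 1 else 0 with hα
  set β : K := e.symm fun j : Fin n => if (S (Fin.natAdd n j)).flipsBit then 1 else 0 with hβ
  have hαβ : α ≠ 0 ∨ β ≠ 0 := by
    obtain ⟨k, hk⟩ := hfl
    revert hk
    refine Fin.addCases (motive := fun k => (S k).flipsBit = true → α ≠ 0 ∨ β ≠ 0)
      (fun i hi => Or.inl fun h0 => ?_) (fun j hj => Or.inr fun h0 => ?_) k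
    · have h1 := congrFun (congrArg e h0) i
      rw [hα, AddEquiv.apply_symm_apply, map_zero, Pi.zero_apply] at h1
      simp only [hi, if_true] at h1
      exact h10 h1
    · have h1 := congrFun (congrArg e h0) j
      rw [hβ, AddEquiv.apply_symm_apply, map_zero, Pi.zero_apply] at h1
      simp only [hj, if_true] at h1
      exact h10 h1
  refine le_trans (Finset.card_le_card_of_injOn
    (fun w : QReg (n + n) => e.symm fun i : Fin n => if w (Fin.castAdd n i) then 1 else 0) ?_ ?_)
    (card_filter_cube_diff_le_two (two_eq_zero_of_card hK) α β hαβ)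
  · intro w hw
    rw [Finset.mem_coe, Finset.mem_filter] at hw ⊢
    refine ⟨Finset.mem_univ _, ?_⟩
    obtain ⟨h1, h2⟩ := hw.2
    rw [bits_xor, map_add, ← hα] at h2
    apply e.injective
    rw [map_add, hβ, AddEquiv.apply_symm_apply]
    funext j
    rw [Pi.add_apply]
    have h1j := congrFun h1 j
    have h2j := congrFun h2 j
    rw [h1j] at h2j
    exact zmod_two_add_eq_bit _ _ _ h2j
  · intro w₁ hw₁ w₂ hw₂ heq
    rw [Finset.mem_coe, Finset.mem_filter] at hw₁ hw₂
    dsimp only at heq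
    have hx : (fun i : Fin n => w₁ (Fin.castAdd n i)) = fun i => w₂ (Fin.castAdd n i) :=
      bits_injective (e.symm.injective heq)
    refine qreg_ext_of_castAdd_natAdd hx ?_
    rw [hw₁.2.1, hw₂.2.1, heq]

/-- The main estimate, stated on the nose of the route item. -/
theorem cubeGraphFlat_main (n : ℕ) (K : Type) [Field K] [Fintype K] (hK : Fintype.card K = 2 ^ n)
    (e : K ≃+ (Fin n → ZMod 2)) (S : Fin (n + n) → Pauli) (hS : S ≠ fun _ => Pauli.I) :
    ‖star (fun w : QReg (n + n) => if (fun j : Fin n => w (Fin.natAdd n j)) = (fun j : Fin n => decide (e ((e.symm (fun i : Fin n => if w (Fin.castAdd n i) then 1 else 0)) ^ 3) j = 1)) then (1 : ℂ) else 0) ⬝ᵥ (pauliString S).mulVec (fun w : QReg (n + n) => if (fun j : Fin n => w (Fin.natAdd n j)) = (fun j : Fin n => decide (e ((e.symm (fun i : Fin n => if w (Fin.castAdd n i) then 1 else 0)) ^ 3) j = 1)) then (1 : ℂ) else 0)‖ ≤ 2 * Real.sqrt 2 ^ n := by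
  classical
  have h10 : (1 : ZMod 2) ≠ 0 := by decide
  have hsqrt : (1 : ℝ) ≤ Real.sqrt 2 ^ n := by
    refine one_le_pow₀ ?_
    rw [show (1 : ℝ) = Real.sqrt 1 from Real.sqrt_one.symm]
    exact Real.sqrt_le_sqrt (by norm_num)
  by_cases hfl : ∃ k, (S k).flipsBit = true
  · -- X-type: at most two unimodular terms
    refine le_trans (norm_indicator_dot_le_card S _) ?_
    refine le_trans (Nat.cast_le.2 (card_cube_graph_pairs_le_two hK e S hfl)) ?_
    push_cast
    linarith
  · -- Z-type: a Walsh sum of the cube map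
    push Not at hfl
    have hfl' : ∀ k, (S k).flipsBit = false := fun k => Bool.eq_false_iff.mpr (hfl k)
    have hsum := graph_dot_eq_sum_of_noflip
      (fun x : QReg n => fun j : Fin n =>
        decide (e ((e.symm fun i : Fin n => if x i then 1 else 0) ^ 3) j = 1)) S hfl'
    rw [hsum]
    simp only [rowPhase_eq_sign_of_noflip S hfl', decide_eq_true_eq, bit_eq_self]
    simp only [← Complex.ofReal_prod, ← Complex.ofReal_mul, ← Complex.ofReal_sum, prod_sign_eq,
      sign_mul_sign]
    rw [Complex.norm_real, Real.norm_eq_abs]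
    -- the two additive functionals `φ u = c · e u`, `ψ v = d · e v`
    let φ : K →+ ZMod 2 := AddMonoidHom.mk'
      (fun u => ∑ i : Fin n, (if S (Fin.castAdd n i) = Pauli.Z then (1 : ZMod 2) else 0) * e u i)
      (fun u v => by simp only [map_add, Pi.add_apply, mul_add, Finset.sum_add_distrib])
    let ψ : K →+ ZMod 2 := AddMonoidHom.mk'
      (fun u => ∑ j : Fin n, (if S (Fin.natAdd n j) = Pauli.Z then (1 : ZMod 2) else 0) * e u j)
      (fun u v => by simp only [map_add, Pi.add_apply, mul_add, Finset.sum_add_distrib])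
    have hφ : ∀ u, φ u = ∑ i : Fin n, (if S (Fin.castAdd n i) = Pauli.Z then (1 : ZMod 2) else 0) * e u i :=
      fun u => rfl
    have hψ : ∀ u, ψ u = ∑ j : Fin n, (if S (Fin.natAdd n j) = Pauli.Z then (1 : ZMod 2) else 0) * e u j :=
      fun u => rfl
    -- reindex the data register by `K`
    have hbij : Function.Bijective (fun x : QReg n => e.symm fun i => if x i then (1 : ZMod 2) else 0) := by
      rw [Fintype.bijective_iff_injective_and_card]
      refine ⟨fun x y hxy => bits_injective (e.symm.injective hxy), ?_⟩
      rw [hK, Fintype.card_fun, Fintype.card_bool, Fintype.card_fin]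
    rw [Fintype.sum_bijective _ hbij _ (fun u => if φ u + ψ (u ^ 3) = 0 then (1 : ℝ) else -1) ?_]
    · by_cases hψ0 : ψ = 0
      · -- all letters on the value register are `I`, so some data letter is `Z` and `φ ≠ 0`
        have hd : ∀ j, S (Fin.natAdd n j) = Pauli.I := by
          intro j
          rcases eq_I_or_eq_Z_of_flipsBit (hfl' (Fin.natAdd n j)) with h | h
          · exact h
          · exfalso
            have h1 := DFunLike.congr_fun hψ0 (e.symm (Pi.single j 1))
            rw [hψ, AddMonoidHom.zero_apply, AddEquiv.apply_symm_apply, Finset.sum_eq_single j,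
              if_pos h, Pi.single_eq_same, one_mul] at h1
            · exact h10 h1
            · intro j' _ hj'
              simp [hj']
            · simp
        have hφ0 : φ ≠ 0 := by
          obtain ⟨k, hk⟩ := Function.ne_iff.1 hS
          revert hk
          refine Fin.addCases (motive := fun k => S k ≠ Pauli.I → φ ≠ 0) (fun i hi => ?_)
            (fun j hj => absurd (hd j) hj) k
          have hZ : S (Fin.castAdd n i) = Pauli.Z := (eq_I_or_eq_Z_of_flipsBit (hfl' _)).resolve_left hi
          intro h0
          have h1 := DFunLike.congr_fun h0 (e.symm (Pi.single i 1))
          rw [hφ, AddMonoidHom.zero_apply, AddEquiv.apply_symm_apply, Finset.sum_eq_single i,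
            if_pos hZ, Pi.single_eq_same, one_mul] at h1
          · exact h10 h1
          · intro i' _ hi'
            simp [hi']
          · simp
        have hψu : ∀ u : K, ψ (u ^ 3) = 0 := fun u => by rw [hψ0, AddMonoidHom.zero_apply]
        simp_rw [hψu, add_zero]
        rw [sum_sign_eq_zero φ hφ0, abs_zero]
        positivity
      · exact abs_walsh_cube_le hK φ ψ hψ0
    · intro x
      simp only [hφ, hψ, AddEquiv.apply_symm_apply]

/-- **Item `CubeGraphFlat` (stmt-QuantumAdvantage-9836), proved.** For every finite field `K` with
`2 ^ n` elements and every additive identification `e : K ≃+ (Fin n → ZMod 2)`, the unnormalised graph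
vector `g = Σ_x |x⟩|e((e⁻¹x)³)⟩` on `n + n` qubits has `|⟨g| σ_S |g⟩| ≤ 2·√2ⁿ` for every Pauli string
`S ≠ I`: an `X`-containing string pairs graph points along a non-trivial differential of the APN map
`x ↦ x³` (≤ 2 unimodular terms); a `Z`-type string gives a Walsh coefficient of `x³`, bounded by
near-bentness (Gold 1968; Nyberg 1993; Carlet 2021 ch. 11). -/
theorem CubeGraphFlat_proof :
    Summit.QuantumAdvantage.QuantumAdvantage.Theses.SymplecticPurity.CubeGraphFlat := by
  unfold Summit.QuantumAdvantage.QuantumAdvantage.Theses.SymplecticPurity.CubeGraphFlat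
  intro n K _ _ hK e S hS
  exact cubeGraphFlat_main n K hK e S hS

end Summit.QuantumAdvantage.QuantumAdvantage.Theorems.SymplecticPurity
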